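import Mathlib
import Literature.Analysis.FluidPDE.LorentzSpaceRegularityCriteria
import Literature.Analysis.FluidPDE.NSCriticalClosureHolds
import Literature.Analysis.FluidPDE.NSCriticalClosureBesovHolds
import Literature.Analysis.FunctionSpaces.LorentzDiagonal
import Literature.Analysis.FluidPDE.LorentzSpaceRegularityCriteriaHolds
import Literature.Analysis.FluidPDE.SereginZhou2020ScaledEnergies
import HarnessLib.Audit
import HarnessLib

/-!
# Blow-up scenario census — block F: row F8′ (Lorentz half), `L^∞_t L^{3,q}_x`, `3 ≤ q < ∞`

File of block F of the cell `pub/ns-census` census (`SCENARIO-CENSUS.md` v1.18, seat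
ns-census-lead g3; key `Row_F8pL` reserved there), route-independent (Literature imports only).

**The cell.** Row F8′ = forward · Type I ∨ II · no symmetry · census frame (classical on
`ℝ³ × [0,T)`, Leray–Hopf from a rapidly decaying datum) with `sup_{0≤t<T} ‖u(t)‖_{L^{3,q}} < ∞`,
`3 ≤ q < ∞` (Lorentz): extension past `T`.  Print: N. C. Phuc, J. Math. Fluid Mech. 17 (2015),
Thm 1.7 and the remark following it; P. G. Lemarié-Rieusset, 2nd ed., Thm 15.6 (b).  In the tree
the cell is the named fact `hasSmoothExtensionPast_of_eLorentzNormPow_bounded`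
(`LorentzSpaceRegularityCriteria.lean`, cross-cell typer g22, 2026-08-28; no `_holds`) — value
EXCLUDED-IN-PRINT-NOT-TREE.  Its Besov half `L^∞_t Ḃ^{-1+3/r}_{r,q}`, `3 < r, q < ∞`, is row
F8′B (`Row_F8pB`, EXCLUDED-IN-TREE, `ScenarioCensusForwardAnnex.lean`), its `L³` form is row F6sup
(`Row_F6sup`, EXCLUDED-IN-TREE, same file).

**What this file types.**
* `Row_F8pL` — the cell, ALIAS of the named fact BY NAME (as `Row_F17`, `Row_S6`).
* `Row_F8pLq q` — the cell at a fixed second exponent `q` (same binders, `q` pulled out; vacuous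
  off `3 ≤ q < ∞`), with `row_F8pL_iff_forall : Row_F8pL ↔ ∀ q, Row_F8pLq q`.
* **`row_F8pLq_three : Row_F8pLq 3` — PROVED**: `L^{3,3} = L³`
  (`FunctionSpaces.eLpNorm_rpow_eq_mul_eLorentzNormPow_self`, layer cake), so the slice `q = 3`
  IS row F6sup (`hasSmoothExtensionPast_of_eLpNorm_three_bounded_holds`, ESS 2003 / Seregin 2012).
  The sub-cell `q = 3` of F8′ is EXCLUDED-IN-TREE.
* **`row_F8pLq_of_lorentzBesov` — PROVED bridge for `3 < q < ∞`**: IF every a.e.-strongly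
  measurable `f : ℝ³ → ℝ³` with `eLorentzNormPow f 3 q < ∞` is represented by a tempered
  distribution `U` with `‖U‖_{Ḃ^{-1+3/q}_{q,q}} ≤ C · (eLorentzNormPow f 3 q)^{1/q}` for a finite
  `C` (the embedding `L^{3,q}(ℝ³) ⊂ Ḃ^{-1+3/q}_{q,q}(ℝ³)`, `q > 3`, printed by Phuc loc. cit.
  p. 4 as the comparison with Gallagher–Koch–Planchon; real interpolation), THEN `Row_F8pLq q` —
  by row F8′B at `r = q` (`hasSmoothExtensionPast_of_eHomBesovNorm_bounded_holds`).  The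
  embedding is taken as an explicit hypothesis (no named fact is introduced here); with it the
  cells `3 < q < ∞` are one embedding lemma away from EXCLUDED-IN-TREE (census v1.18 note on F8′).
* `row_F8pL_of_forall_gt` — `(∀ q, 3 < q → Row_F8pLq q) → Row_F8pL` (the `q = 3` slice being
  proved).

Namespace `Summit.NavierStokesRegularity.NavierStokesRegularity.Theorems.ScenarioCensus`.
No summit statement is proved here; nothing in this file is a claim about NS regularity beyond
the displayed implications between census rows.
-/

noncomputable section

-- the summit and its single problem share the name `NavierStokesRegularity` (D-0017 nested layout)
set_option linter.dupNamespace false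

open Set Function Filter Topology MeasureTheory Metric
open scoped NNReal ENNReal

namespace Summit.NavierStokesRegularity.NavierStokesRegularity.Theorems.ScenarioCensus

open Literature.Analysis Literature.Analysis.FluidPDE Literature.Analysis.FunctionSpaces

/-! ## Row F8′ (Lorentz half): the cell and its `q`-slices -/

/-- **Row F8′ (Lorentz half)** (I∨II · none · census frame ∩ `L^∞_t L^{3,q}_x`, `3 ≤ q < ∞`):
extension past `T` — ALIAS of the named fact `hasSmoothExtensionPast_of_eLorentzNormPow_bounded`
(Phuc 2015 Thm 1.7 + remark; Lemarié-Rieusset 2nd ed. Thm 15.6 (b)), NOT discharged in tree: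
EXCLUDED-IN-PRINT-NOT-TREE (typed print row; no `row_F8pL_excluded`).
(ref: Phuc2015, Thm 1.7; LemarieRieusset2023, Thm 15.6 (b)) -/
def Row_F8pL : Prop := hasSmoothExtensionPast_of_eLorentzNormPow_bounded

/-- **Row F8′ at a fixed second exponent `q`** (the `q`-slice of the cell; vacuous unless
`3 ≤ q < ∞`): a classical solution on `ℝ³ × [0,T)`, Leray–Hopf from a rapidly decaying datum, with
`⨆_{t ∈ [0,T)} eLorentzNormPow (u t) 3 q volume < ∞` (`= 3⁻¹ sup_t ‖u(t)‖^q_{L^{3,q}}`), extends as a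
classical solution past `T`.  Same binders as the named fact with `q` pulled out
(`row_F8pL_iff_forall`). (ref: Phuc2015, Thm 1.7 and the remark following it) -/
def Row_F8pLq (q : ℝ≥0∞) : Prop :=
  3 ≤ q → q < ⊤ → ∀ (ν T : ℝ), 0 < ν → 0 < T →
    ∀ (u : ℝ → EuclideanSpace ℝ (Fin 3) → EuclideanSpace ℝ (Fin 3))
      (p : ℝ → EuclideanSpace ℝ (Fin 3) → ℝ),
      IsClassicalNSSolutionOn (Ico 0 T) ν 0 u p → IsLerayHopfOn T ν 0 (u 0) u →
        HasRapidSpatialDecay (u 0) →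
          (⨆ t ∈ Ico 0 T, eLorentzNormPow (u t) 3 q volume) < ⊤ →
            HasSmoothExtensionPast ν 0 u T

/-- Row F8′ is the conjunction of its `q`-slices (reshuffling of binders). [folklore] -/
theorem row_F8pL_iff_forall : Row_F8pL ↔ ∀ q, Row_F8pLq q := by
  constructor
  · intro h q h3q hqtop ν T hν hT u p hcl hLH hdec hsup
    exact h ν T hν hT u p q h3q hqtop hcl hLH hdec hsup
  · intro h ν T hν hT u p q h3q hqtop hcl hLH hdec hsup
    exact h q h3q hqtop ν T hν hT u p hcl hLH hdec hsup

/-! ## The slice `q = 3` is row F6sup (`L^{3,3} = L³`) — PROVED -/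

/-- **Row F8′ at `q = 3` is a theorem of the tree**: `L^{3,3} = L³` with
`‖f‖³_{L³} = 3 · eLorentzNormPow f 3 3` (layer cake, `eLpNorm_rpow_eq_mul_eLorentzNormPow_self`;
the slices `u t` of a classical solution are smooth, hence measurable), so a bound on
`⨆_t eLorentzNormPow (u t) 3 3` bounds `⨆_t ‖u(t)‖_{L³}` and row F6sup
(`hasSmoothExtensionPast_of_eLpNorm_three_bounded_holds`, Escauriaza–Seregin–Šverák 2003 Thm 1.4 /
Seregin 2012 Thm 1.1) gives the extension.  Sub-cell `q = 3` of F8′: EXCLUDED-IN-TREE.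
[cite: Seregin2012, Thm. 1.1 (with EscauriazaSereginSverak2003 Thm. 1.4); Grafakos2014, §1.4.2 (L^{p,p} = L^p)] -/
theorem row_F8pLq_three : Row_F8pLq 3 := by
  intro _ _ ν T hν hT u p hcl hLH hdec hsup
  refine hasSmoothExtensionPast_of_eLpNorm_three_bounded_holds ν T hν hT u p hcl hLH hdec ?_
  set M := ⨆ t ∈ Ico (0 : ℝ) T, eLorentzNormPow (u t) 3 3 volume with hM
  have h3 : (3 : ℝ≥0∞) ≠ 0 := by norm_num
  have h3' : (3 : ℝ≥0∞) ≠ ⊤ := ENNReal.ofNat_ne_top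
  have hbound : ∀ t ∈ Ico (0 : ℝ) T,
      eLpNorm (u t) 3 volume ≤ (ENNReal.ofReal 3 * M) ^ (1 / (3 : ℝ)) := by
    intro t ht
    have hmeas : AEStronglyMeasurable (u t) volume :=
      (hcl.contDiff_velocity ht).continuous.aestronglyMeasurable
    have hle : eLorentzNormPow (u t) 3 3 volume ≤ M :=
      le_iSup₂ (f := fun t (_ : t ∈ Ico (0 : ℝ) T) => eLorentzNormPow (u t) 3 3 volume) t ht
    have hpow : eLpNorm (u t) 3 volume ^ (3 : ℝ) ≤ ENNReal.ofReal 3 * M := by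
      have h := eLpNorm_rpow_eq_mul_eLorentzNormPow_self (μ := volume) hmeas h3 h3'
      rw [ENNReal.toReal_ofNat] at h
      rw [h]
      exact mul_le_mul_right hle (ENNReal.ofReal 3)
    calc eLpNorm (u t) 3 volume
        = (eLpNorm (u t) 3 volume ^ (3 : ℝ)) ^ (1 / (3 : ℝ)) := by
          rw [← ENNReal.rpow_mul]; norm_num
      _ ≤ (ENNReal.ofReal 3 * M) ^ (1 / (3 : ℝ)) := by gcongr
  calc (⨆ t ∈ Ico (0 : ℝ) T, eLpNorm (u t) 3 volume)
      ≤ (ENNReal.ofReal 3 * M) ^ (1 / (3 : ℝ)) := iSup₂_le hbound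
    _ < ⊤ := ENNReal.rpow_lt_top_of_nonneg (by norm_num)
        (ENNReal.mul_ne_top ENNReal.ofReal_ne_top hsup.ne)

/-! ## The slices `3 < q < ∞` modulo the embedding `L^{3,q} ⊂ Ḃ^{-1+3/q}_{q,q}` — PROVED bridge -/

/-- **Bridge for `3 < q < ∞`** (row F8′ ⇐ row F8′B + one embedding): assume the embedding
`L^{3,q}(ℝ³) ⊂ Ḃ^{-1+3/q}_{q,q}(ℝ³)` in the tree's vocabulary — every a.e.-strongly measurable
`f : ℝ³ → ℝ³` with finite Lorentz functional `eLorentzNormPow f 3 q` is represented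
(`IsDistributionOf`) by a tempered distribution `U` with
`‖U‖_{Ḃ^{-1+3/q}_{q,q}} ≤ C · (eLorentzNormPow f 3 q)^{1/q}` for one finite constant `C` (Phuc 2015,
remark after Thm 1.7, arXiv p. 4: "for `q > 3`, `L^{3,q}(ℝ³) ⊂ Ḃ^{-1+3/q}_{q,q}(ℝ³)`"; real
interpolation).  Then `Row_F8pLq q`: the slices `u t`, `t ∈ [0,T)`, are smooth hence measurable,
their Lorentz functionals are bounded by the supremum `M < ∞`, the chosen representatives `U t`
have `⨆_t ‖U t‖_{Ḃ^{-1+3/q}_{q,q}} ≤ C · M^{1/q} < ∞`, and row F8′B at `r = q`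
(`hasSmoothExtensionPast_of_eHomBesovNorm_bounded_holds`, Gallagher–Koch–Planchon 2016 Thm 1,
PROVED in tree) gives the extension past `T`.  The embedding is an explicit hypothesis, not a
named fact of this file. [cite: GKP2016, Thm. 1; Phuc2015, remark following Thm. 1.7 (arXiv:1407.5129 p. 4)] -/
theorem row_F8pLq_of_lorentzBesov (q : ℝ≥0∞) [Fact (1 ≤ q)] (h3q : 3 < q) (hqtop : q < ⊤)
    (C : ℝ≥0∞) (hC : C < ⊤)
    (hemb : ∀ f : EuclideanSpace ℝ (Fin 3) → EuclideanSpace ℝ (Fin 3),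
      AEStronglyMeasurable f volume → eLorentzNormPow f 3 q volume < ⊤ →
        ∃ U : TemperedDistribution (EuclideanSpace ℝ (Fin 3)) (EuclideanSpace ℂ (Fin 3)),
          IsDistributionOf f U ∧
            eHomBesovNorm (-1 + 3 / q.toReal) q q U ≤
              C * eLorentzNormPow f 3 q volume ^ (1 / q.toReal)) :
    Row_F8pLq q := by
  intro _ _ ν T hν hT u p hcl hLH hdec hsup
  set M := ⨆ t ∈ Ico (0 : ℝ) T, eLorentzNormPow (u t) 3 q volume with hM
  have hle : ∀ t ∈ Ico (0 : ℝ) T, eLorentzNormPow (u t) 3 q volume ≤ M := fun t ht =>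
    le_iSup₂ (f := fun t (_ : t ∈ Ico (0 : ℝ) T) => eLorentzNormPow (u t) 3 q volume) t ht
  have hfin : ∀ t ∈ Ico (0 : ℝ) T, eLorentzNormPow (u t) 3 q volume < ⊤ := fun t ht =>
    lt_of_le_of_lt (hle t ht) hsup
  have hmeas : ∀ t ∈ Ico (0 : ℝ) T, AEStronglyMeasurable (u t) volume := fun t ht =>
    (hcl.contDiff_velocity ht).continuous.aestronglyMeasurable
  classical
  -- the representing distributions, slice by slice (`0` off `[0,T)`, never used there)
  let U : ℝ → TemperedDistribution (EuclideanSpace ℝ (Fin 3)) (EuclideanSpace ℂ (Fin 3)) :=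
    fun t => if ht : t ∈ Ico (0 : ℝ) T then
      Classical.choose (hemb (u t) (hmeas t ht) (hfin t ht)) else 0
  have hU : ∀ t (ht : t ∈ Ico (0 : ℝ) T), IsDistributionOf (u t) (U t) ∧
      eHomBesovNorm (-1 + 3 / q.toReal) q q (U t) ≤
        C * eLorentzNormPow (u t) 3 q volume ^ (1 / q.toReal) := by
    intro t ht
    have h := Classical.choose_spec (hemb (u t) (hmeas t ht) (hfin t ht))
    simp only [U, dif_pos ht]
    exact h
  have hq0 : 0 < q.toReal := ENNReal.toReal_pos (ne_of_gt (lt_trans (by norm_num) h3q)) hqtop.ne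
  refine hasSmoothExtensionPast_of_eHomBesovNorm_bounded_holds ν T hν hT u p U q q h3q hqtop
    h3q hqtop hcl hLH hdec (fun t ht => (hU t ht).1) ?_
  calc (⨆ t ∈ Ico (0 : ℝ) T, eHomBesovNorm (-1 + 3 / q.toReal) q q (U t))
      ≤ C * M ^ (1 / q.toReal) := by
        refine iSup₂_le fun t ht => le_trans (hU t ht).2 ?_
        gcongr
        exact hle t ht
    _ < ⊤ := ENNReal.mul_lt_top hC
        (ENNReal.rpow_lt_top_of_nonneg (by positivity) hsup.ne)

/-- With the `q = 3` slice proved, row F8′ follows from its slices `3 < q < ∞` alone. [folklore] -/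
theorem row_F8pL_of_forall_gt (h : ∀ q, 3 < q → Row_F8pLq q) : Row_F8pL := by
  rw [row_F8pL_iff_forall]
  intro q h3q hqtop
  rcases eq_or_lt_of_le h3q with h3 | h3
  · subst h3
    exact row_F8pLq_three le_rfl hqtop
  · exact h q h3 h3q hqtop

/-! ## Appended 2026-08-28 (typer-1 g4): the embedding is PROVED — cell F8′ EXCLUDED-IN-TREE

The embedding hypothesis of `row_F8pLq_of_lorentzBesov` is now a theorem of the tree
(`Literature.Analysis.FluidPDE.lorentz_three_subset_homBesov`, `LorentzBesovEmbedding.lean`: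
`L^{3,q}(ℝ³) ⊂ Ḃ^{-1+3/r}_{r,q}(ℝ³)`, `3 < r < ∞`, `1 ≤ q < ∞`, dyadic layers + Bernstein), and the
named fact behind `Row_F8pL` is DISCHARGED
(`Literature.Analysis.FluidPDE.hasSmoothExtensionPast_of_eLorentzNormPow_bounded_holds`,
`LorentzSpaceRegularityCriteriaHolds.lean`).  Row F8′ (Lorentz half) becomes EXCLUDED-IN-TREE with
the census's standard one-liner. -/

/-- **Row F8′ (Lorentz half) is a theorem of the tree**: `Row_F8pL` (=
`hasSmoothExtensionPast_of_eLorentzNormPow_bounded`, Phuc 2015 Thm 1.7 + remark / Lemarié-Rieusset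
Thm 15.6 (b) in the census frame) BY NAME from its discharge
`hasSmoothExtensionPast_of_eLorentzNormPow_bounded_holds` (`q = 3`: `L^{3,3} = L³` + ESS/Seregin;
`3 < q < ∞`: `L^{3,q} ⊂ Ḃ^{-1+3/q}_{q,q}` + Gallagher–Koch–Planchon; all proved).  Cell F8′:
EXCLUDED-IN-TREE. [cite: Phuc2015, Thm. 1.7 and the remark following it (arXiv:1407.5129 p. 4)] -/
theorem row_F8pL_excluded : Row_F8pL := hasSmoothExtensionPast_of_eLorentzNormPow_bounded_holds

/-- Every `q`-slice of row F8′ is a theorem of the tree (vacuous off `3 ≤ q < ∞`).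
[cite: Phuc2015, Thm. 1.7 and the remark following it (arXiv:1407.5129 p. 4)] -/
theorem row_F8pLq_excluded (q : ℝ≥0∞) : Row_F8pLq q := (row_F8pL_iff_forall.1 row_F8pL_excluded) q

/-- The embedding hypothesis of `row_F8pLq_of_lorentzBesov` at `r = q`, `3 < q < ∞`, discharged BY
NAME from `lorentz_three_subset_homBesov` (the form consumed by the bridge: one finite constant,
`IsDistributionOf` representative, `‖U‖_{Ḃ^{-1+3/q}_{q,q}} ≤ C · (eLorentzNormPow f 3 q)^{1/q}`).
[cite: Phuc2015, remark following Thm. 1.7 (arXiv:1407.5129 p. 4)] -/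
theorem lorentzBesov_embedding_hypothesis (q : ℝ≥0∞) [Fact (1 ≤ q)] (h3q : 3 < q) (hqtop : q < ⊤) :
    ∃ C : ℝ≥0∞, C < ⊤ ∧ ∀ f : EuclideanSpace ℝ (Fin 3) → EuclideanSpace ℝ (Fin 3),
      AEStronglyMeasurable f volume → eLorentzNormPow f 3 q volume < ⊤ →
        ∃ U : TemperedDistribution (EuclideanSpace ℝ (Fin 3)) (EuclideanSpace ℂ (Fin 3)),
          IsDistributionOf f U ∧
            eHomBesovNorm (-1 + 3 / q.toReal) q q U ≤
              C * eLorentzNormPow f 3 q volume ^ (1 / q.toReal) :=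
  lorentz_three_subset_homBesov (ι := Fin 3) q q h3q hqtop (le_trans (by norm_num) h3q.le) hqtop

/-! ## Appended 2026-08-28 (typer-1 g4, lead g5 NOTE 11:37Z (ii)): row F8″ — Seregin–Zhou 2020 Thm 1.2
## (`L^∞_t Ḃ^{-1}_{∞,∞}` ⇒ bounded scaled energies), BY NAME from the Literature theorem -/

/-- **Row F8″ (Lean key `Row_F8pp`)** (forward · no symmetry · suitable weak solution on `ℝ³ × ]0,T[` in the
energy class with `v ∈ L^∞(0,T; Ḃ^{-1}_{∞,∞})`, packaged as `SereginZhou2020.Hypotheses T v q G`): at every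
`z₀ = (t₀, x₀)`, `t₀ ∈ ]0,T]`, the ESSENTIAL scaled energies `A_ess, E, C` stay bounded on `0 < r < min{1,t₀}/2`
— VERBATIM the statement of `SereginZhou2020.scaledEnergiesEss_lt_top` (Seregin–Zhou 2020 Thm 1.2, faithful
`cknAEss` rendering; the `cknA` rendering is refuted in tree).  EXCLUDED-IN-TREE. (ref: SereginZhou2020, Thm 1.2) -/
def Row_F8pp : Prop :=
  ∀ (T : ℝ) (v : ℝ → EuclideanSpace ℝ (Fin 3) → EuclideanSpace ℝ (Fin 3))
    (q : ℝ → EuclideanSpace ℝ (Fin 3) → ℝ)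
    (G : ℝ → EuclideanSpace ℝ (Fin 3) → EuclideanSpace ℝ (Fin 3) →L[ℝ] EuclideanSpace ℝ (Fin 3)),
    SereginZhou2020.Hypotheses T v q G → ∀ t₀ ∈ Ioc 0 T, ∀ x₀ : EuclideanSpace ℝ (Fin 3),
      (⨆ r ∈ Ioo 0 (min 1 t₀ / 2), cknAEss r (t₀, x₀) v) < ⊤ ∧
      (⨆ r ∈ Ioo 0 (min 1 t₀ / 2), cknE r (t₀, x₀) G) < ⊤ ∧
      (⨆ r ∈ Ioo 0 (min 1 t₀ / 2), cknC r (t₀, x₀) v) < ⊤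

/-- Row F8″ is a theorem of the tree: `SereginZhou2020.scaledEnergiesEss_lt_top`. [cite: SereginZhou2020, Thm 1.2] -/
theorem row_F8pp_excluded : Row_F8pp := SereginZhou2020.scaledEnergiesEss_lt_top

end Summit.NavierStokesRegularity.NavierStokesRegularity.Theorems.ScenarioCensus

end
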